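import Literature.Topology.FourManifolds.HomotopySpheresStablyParallelizableSpinSix
import Literature.Topology.FourManifolds.HomotopySpheresStablyParallelizableEven
import Literature.Topology.FourManifolds.HomotopySpheresStablyParallelizableOrthogonal
import Literature.LinearAlgebra.Matrix.UnitaryGramSchmidtRetraction
import Literature.AlgebraicTopology.FundamentalGroup.TopologicalGroupCovering
import Literature.MathematicalPhysics.QuantumLattice.GaugeGroups
import Literature.AlgebraicTopology.FundamentalGroup.SphereSimplyConnected
import Literature.AlgebraicTopology.Homotopy.SphereMapsHomotopyGroups
import Literature.AlgebraicTopology.Homotopy.HomotopyGroupsGeneralPosition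
import Mathlib.Geometry.Manifold.Instances.Sphere
import HarnessLib

/-!
# The covering `SU(4) → SO(6)` and `πₙ(SO(6)) = 0 ⇐ πₙ(SU(4)) = 0` (`n ≥ 2`); Bott's `π₆(SO(8)) = 0` from `π₆(SU(4)) = 0`

Topic `Literature/Topology/FourManifolds`, sibling of `…SpinSix.lean` (the homomorphism
`toO6 : SU(4) → O(6)` by explicit matrices, its kernel `{±1}` and image `⊇ SO(6)`; Porteous,
*Clifford Algebras and the Classical Groups*, Prop. 17.3 `Spin(6) ≅ SU(4)`), completing the
transport of the named fact `Literature.Topology.FourManifolds.Bott1959_sphereMapsToStableFramesExtend_six`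
(`π₆(SO(8), 1) = 0`, Bott 1959) to the unitary side. Everything PROVED; no named facts:

* §1 `SU(N)` (Mathlib's `Matrix.specialUnitaryGroup (Fin N) ℂ`) is a compact Hausdorff topological
  group: the tree's instances `Matrix.specialUnitaryGroup.instIsTopologicalGroup` and
  `Matrix.specialUnitaryGroup.instCompactSpace` (`Literature/MathematicalPhysics/QuantumLattice/GaugeGroups.lean`)
  are imported and used as they are (nothing is re-declared here).
* §2 **`det (toO6 A) = 1`** (`SU(4)` is path connected — `UnitaryGramSchmidtRetraction.lean` — and
  `det = ±1` on `O(6)` is locally constant), so **`toSO6 : SU(4) →* SO(6)`**, continuous,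
  surjective, with kernel `{±1}`; by the tree's `isCoveringMap_monoidHom` (a continuous surjective
  homomorphism with finite kernel from a compact Hausdorff group is a covering map) it is a
  **two-sheeted covering** (Hatcher §3.D for `S³ → SO(3)`, `S³ × S³ → SO(4)`; here `Spin(6) → SO(6)`).
* §3 **transfer**: for `m ≥ 2`, every continuous `𝕊ᵐ → SO(6)` lifts to `SU(4)` (Mathlib's
  `IsCoveringMap.existsUnique_continuousMap_lifts`; `𝕊ᵐ` is simply connected,
  `simplyConnectedSpace_euclideanSphere`), so if `π_ m (SU(4), 1) = 0` then all maps `𝕊ᵐ → SO(6)` are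
  null-homotopic and `π_ m (SO(6), 1) = 0` (Hatcher Prop. 4.1: coverings induce isomorphisms on
  `πₙ`, `n ≥ 2` — the surjectivity half).
* §4 **`Bott1959_sphereMapsToStableFramesExtend_six_of_specialUnitaryGroup_four`**: the named fact
  follows from `Subsingleton (π_ 6 SU(4) 1)`, i.e. from `π₆(SU(4)) = 0` — the value delivered by
  complex Bott periodicity (`π₆(U(4)) = π₆(U) = 0`, Bott 1959 §1: `π_k(U) = 0, ℤ` for `k` even, odd),
  via the tree's `Bott1959_sphereMapsToStableFramesExtend_six_of_specialOrthogonalGroup_six`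
  (`…Even.lean`: `π₆(SO(6)) = 0 ⇒ π₆(SO(7)) = 0 ⇒ π₆(SO(8)) = 0 ⇒` the fact).

## References

* I. R. Porteous, *Clifford Algebras and the Classical Groups*, CUP (1995), Prop. 17.3
  (`Spin(6) ≅ SU(4)`). [Porteous1995]
* A. Hatcher, *Algebraic Topology*, CUP (2002), §3.D (the coverings `Spin → SO` in low dimensions),
  §4.1 Prop. 4.1 (`p_* : πₙ(X̃) → πₙ(X)` is an isomorphism for `n ≥ 2`). [HatcherAT2002]
* R. Bott, *The stable homotopy of the classical groups*, Ann. of Math. (2) 70 (1959), 313–337, §1,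
  Cor. to Thm. II, (1.5), p. 315. doi:10.2307/1970106 [Bott1959]
-/

noncomputable section

open Literature.AlgebraicTopology.Homotopy Literature.AlgebraicTopology.FundamentalGroup
open Literature.LinearAlgebra.Matrix
open scoped Manifold Topology Topology.Homotopy Matrix
open Set Metric Matrix

namespace Literature.Topology.FourManifolds

namespace SpinSix

/-! ### 1. `SU(N)` is a compact Hausdorff topological group: instances from `GaugeGroups.lean` -/

example : CompactSpace (Matrix.specialUnitaryGroup (Fin 4) ℂ) := inferInstance
example : IsTopologicalGroup (Matrix.specialUnitaryGroup (Fin 4) ℂ) := inferInstance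

/-! ### 2. `det ∘ toO6 = 1`; the covering homomorphism `toSO6 : SU(4) →* SO(6)` -/

section Covering

/-- **`det (toO6 A) = 1` for `A ∈ SU(4)`**: `SU(4)` is path connected, `toO6` is continuous with
values in `O(6)` where `det = ±1` is locally constant, and `toO6 1 = 1`. [cite: Porteous1995, Prop. 17.3] -/
theorem det_toO6 (A : Matrix.specialUnitaryGroup (Fin 4) ℂ) : (toO6 A.1).det = 1 :=
  det_eq_one_of_preconnectedSpace (T := Matrix.specialUnitaryGroup (Fin 4) ℂ)
    (K := fun A => toO6 A.1) (continuous_toO6.comp continuous_subtype_val)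
    (fun A => toO6_mem_orthogonalGroup A.2) (t₀ := 1) (by rw [OneMemClass.coe_one, toO6_one, Matrix.det_one]) A

/-- `toO6 A ∈ SO(6)` for `A ∈ SU(4)`. [cite: Porteous1995, Prop. 17.3] -/
theorem toO6_mem_specialOrthogonalGroup (A : Matrix.specialUnitaryGroup (Fin 4) ℂ) :
    toO6 A.1 ∈ Matrix.specialOrthogonalGroup (Fin 6) ℝ :=
  Matrix.mem_specialOrthogonalGroup_iff.2 ⟨toO6_mem_orthogonalGroup A.2, det_toO6 A⟩

/-- **The covering homomorphism `SU(4) → SO(6)`** (`Spin(6) ≅ SU(4)`). [cite: Porteous1995, Prop. 17.3] -/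
def toSO6 : Matrix.specialUnitaryGroup (Fin 4) ℂ →* Matrix.specialOrthogonalGroup (Fin 6) ℝ where
  toFun A := ⟨toO6 A.1, toO6_mem_specialOrthogonalGroup A⟩
  map_one' := Subtype.ext (by
    change toO6 ((1 : Matrix.specialUnitaryGroup (Fin 4) ℂ) : Matrix (Fin 4) (Fin 4) ℂ) =
      ((1 : Matrix.specialOrthogonalGroup (Fin 6) ℝ) : Matrix (Fin 6) (Fin 6) ℝ)
    rw [OneMemClass.coe_one, OneMemClass.coe_one, toO6_one])
  map_mul' A B := Subtype.ext (by
    change toO6 (A.1 * B.1) = toO6 A.1 * toO6 B.1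
    exact toO6_mul A.1 B.2)

/-- The matrix of `toSO6 A` is `toO6 A`. [folklore] -/
@[simp] theorem coe_toSO6 (A : Matrix.specialUnitaryGroup (Fin 4) ℂ) : (toSO6 A).1 = toO6 A.1 := rfl

/-- `toSO6` is continuous. [folklore] -/
theorem continuous_toSO6 : Continuous toSO6 :=
  (continuous_toO6.comp continuous_subtype_val).subtype_mk _

/-- **`toSO6` is surjective.** [cite: Porteous1995, Prop. 17.3] -/
theorem surjective_toSO6 : Function.Surjective toSO6 := fun g => by
  obtain ⟨A, hA, hAg⟩ := exists_toO6_eq g.2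
  exact ⟨⟨A, hA⟩, Subtype.ext hAg⟩

/-- **The kernel of `toSO6` is `{1, -1}`.** [cite: Porteous1995, Prop. 17.3] -/
theorem mem_ker_toSO6_iff (A : Matrix.specialUnitaryGroup (Fin 4) ℂ) :
    A ∈ toSO6.ker ↔ A.1 = 1 ∨ A.1 = -1 := by
  rw [MonoidHom.mem_ker]
  constructor
  · intro h
    exact eq_one_or_eq_neg_one_of_toO6_eq_one A.2 (by rw [← coe_toSO6, h]; rfl)
  · rintro (h | h)
    · exact Subtype.ext (by rw [coe_toSO6, h, toO6_one]; rfl)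
    · exact Subtype.ext (by rw [coe_toSO6, h, toO6_neg_one]; rfl)

/-- The kernel of `toSO6` is finite (two elements). [folklore] -/
theorem finite_ker_toSO6 : (toSO6.ker : Set (Matrix.specialUnitaryGroup (Fin 4) ℂ)).Finite := by
  refine ((Set.finite_singleton (⟨-1, neg_one_mem_specialUnitaryGroup⟩ : Matrix.specialUnitaryGroup (Fin 4) ℂ)).insert
    (1 : Matrix.specialUnitaryGroup (Fin 4) ℂ)).subset ?_
  intro A hA
  rw [Set.mem_insert_iff, Set.mem_singleton_iff]
  rcases (mem_ker_toSO6_iff A).1 hA with h | h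
  · exact Or.inl (Subtype.ext h)
  · exact Or.inr (Subtype.ext h)

/-- **`SU(4) → SO(6)` is a covering map** (a continuous surjective homomorphism with finite kernel
from a compact Hausdorff group; the two-sheeted universal cover `Spin(6) → SO(6)`).
[cite: Porteous1995, Prop. 17.3] [cite: HatcherAT2002, §3.D] -/
theorem isCoveringMap_toSO6 : IsCoveringMap toSO6 :=
  isCoveringMap_monoidHom toSO6 continuous_toSO6 surjective_toSO6 finite_ker_toSO6

end Covering

/-! ### 3. Transfer of `π_m = 0` from `SU(4)` to `SO(6)` (`m ≥ 2`) -/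

section Transfer

variable {m : ℕ}

/-- `π_ m (SU(4), B) = 0` for every `B` once `π_ m (SU(4), 1) = 0` (left translation). [folklore] -/
theorem subsingleton_homotopyGroup_specialUnitaryGroup_of_one
    (h : Subsingleton (π_ m (Matrix.specialUnitaryGroup (Fin 4) ℂ) 1))
    (B : Matrix.specialUnitaryGroup (Fin 4) ℂ) :
    Subsingleton (π_ m (Matrix.specialUnitaryGroup (Fin 4) ℂ) B) := by
  let φ : C(Matrix.specialUnitaryGroup (Fin 4) ℂ, Matrix.specialUnitaryGroup (Fin 4) ℂ) :=
    ⟨fun C => B⁻¹ * C, continuous_const.mul continuous_id⟩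
  let ψ : C(Matrix.specialUnitaryGroup (Fin 4) ℂ, Matrix.specialUnitaryGroup (Fin 4) ℂ) :=
    ⟨fun C => B * C, continuous_const.mul continuous_id⟩
  have hψφ : (ψ.comp φ).Homotopic (ContinuousMap.id _) := by
    rw [show ψ.comp φ = ContinuousMap.id _ from ContinuousMap.ext fun C => mul_inv_cancel_left B C]
  have hφB : φ B = 1 := inv_mul_cancel B
  have h1 : Subsingleton (π_ m (Matrix.specialUnitaryGroup (Fin 4) ℂ) (φ B)) := by
    rw [hφB]; exact h
  exact subsingleton_homotopyGroup_of_leftHomotopyInverse φ ψ hψφ B h1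

/-- **All maps `𝕊ᵐ → SU(4)` are null-homotopic if `π_ m (SU(4), 1) = 0`** (`SU(4)` is path connected;
Hatcher §4.1 (3) ⇒ (1)). [cite: HatcherAT2002, §4.1 (p. 346)] -/
theorem nullhomotopic_specialUnitaryGroup_of_subsingleton
    (h : Subsingleton (π_ m (Matrix.specialUnitaryGroup (Fin 4) ℂ) 1))
    (K : C(sphere (0 : EuclideanSpace ℝ (Fin (m + 1))) 1, Matrix.specialUnitaryGroup (Fin 4) ℂ)) : K.Nullhomotopic := by
  have hπ : 1 ≤ m → ∀ y : Matrix.specialUnitaryGroup (Fin 4) ℂ, Subsingleton (π_ m (Matrix.specialUnitaryGroup (Fin 4) ℂ) y) :=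
    fun _ y => subsingleton_homotopyGroup_specialUnitaryGroup_of_one h y
  exact ⟨1, homotopic_const_of_sphere_of_subsingleton_homotopyGroup (E := EuclideanSpace ℝ (Fin (m + 1)))
    (m := m) finrank_euclideanSpace_fin hπ K 1⟩

/-- **Every continuous map `𝕊ᵐ → SO(6)`, `m ≥ 2`, is null-homotopic if `π_ m (SU(4), 1) = 0`**: lift it
through the covering `toSO6` (`𝕊ᵐ` is simply connected and locally path connected), contract the
lift in `SU(4)` and push the null-homotopy down (Hatcher Prop. 4.1, surjectivity of
`p_* : πₘ(SU(4)) → πₘ(SO(6))`). [cite: HatcherAT2002, Prop. 4.1] [cite: Porteous1995, Prop. 17.3] -/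
theorem nullhomotopic_specialOrthogonalGroup_six_of_specialUnitaryGroup (hm : 2 ≤ m)
    (h : Subsingleton (π_ m (Matrix.specialUnitaryGroup (Fin 4) ℂ) 1))
    (k : C(sphere (0 : EuclideanSpace ℝ (Fin (m + 1))) 1, Matrix.specialOrthogonalGroup (Fin 6) ℝ)) :
    k.Nullhomotopic := by
  haveI : SimplyConnectedSpace (sphere (0 : EuclideanSpace ℝ (Fin (m + 1))) 1) :=
    simplyConnectedSpace_euclideanSphere (n := m) hm
  haveI : LocallyPathConnectedSpace (sphere (0 : EuclideanSpace ℝ (Fin (m + 1))) 1) :=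
    ChartedSpace.locallyPathConnectedSpace (EuclideanSpace ℝ (Fin m)) _
  let u₀ : sphere (0 : EuclideanSpace ℝ (Fin (m + 1))) 1 := ⟨EuclideanSpace.single 0 1, by simp⟩
  obtain ⟨A₀, hA₀⟩ := surjective_toSO6 (k u₀)
  obtain ⟨K, -, hK⟩ := (isCoveringMap_toSO6.existsUnique_continuousMap_lifts k u₀ A₀ hA₀).exists
  obtain ⟨A₁, hA₁⟩ := nullhomotopic_specialUnitaryGroup_of_subsingleton h K
  let R : C(Matrix.specialUnitaryGroup (Fin 4) ℂ, Matrix.specialOrthogonalGroup (Fin 6) ℝ) := ⟨toSO6, continuous_toSO6⟩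
  have hk : R.comp K = k := ContinuousMap.ext fun u => congr_fun hK u
  have h1 : (R.comp K).Homotopic (R.comp (ContinuousMap.const _ A₁)) := (ContinuousMap.Homotopic.refl R).comp hA₁
  rw [hk] at h1
  exact ⟨toSO6 A₁, h1⟩

/-- **`π_ m (SO(6), 1) = 0` follows from `π_ m (SU(4), 1) = 0` for `m ≥ 2`** (the covering
`SU(4) → SO(6)`; Hatcher Prop. 4.1, §4.1 criterion (1) ⇒ (3)). [cite: HatcherAT2002, Prop. 4.1]
[cite: Porteous1995, Prop. 17.3] -/
theorem subsingleton_homotopyGroup_specialOrthogonalGroup_six_of_specialUnitaryGroup (hm : 2 ≤ m)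
    (h : Subsingleton (π_ m (Matrix.specialUnitaryGroup (Fin 4) ℂ) 1)) :
    Subsingleton (π_ m (Matrix.specialOrthogonalGroup (Fin 6) ℝ) 1) :=
  subsingleton_homotopyGroup_specialOrthogonalGroup_of_nullhomotopic
    (nullhomotopic_specialOrthogonalGroup_six_of_specialUnitaryGroup hm h)

/-- The same transfer stated with null-homotopy through invertible matrices: if every map
`𝕊ᵐ → SU(4)` (`m ≥ 2`) is null-homotopic after inclusion into `{A ∈ M₄(ℂ) | det A ∈ ℂˣ}` then
`π_ m (SO(6), 1) = 0` (the Gram–Schmidt retraction `suRetract` brings the null-homotopy back into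
`SU(4)`). This is the form fed by `π_ m (GL₄(ℂ)) = 0`. [cite: HatcherAT2002, §3.D and Prop. 4.1] -/
theorem subsingleton_homotopyGroup_specialOrthogonalGroup_six_of_nullhomotopic_suIncl (hm : 2 ≤ m)
    (h : ∀ K : C(sphere (0 : EuclideanSpace ℝ (Fin (m + 1))) 1, Matrix.specialUnitaryGroup (Fin 4) ℂ),
      (suIncl.comp K).Nullhomotopic) :
    Subsingleton (π_ m (Matrix.specialOrthogonalGroup (Fin 6) ℝ) 1) := by
  have h1 : ∀ K : C(sphere (0 : EuclideanSpace ℝ (Fin (m + 1))) 1, Matrix.specialUnitaryGroup (Fin 4) ℂ), K.Nullhomotopic :=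
    fun K => nullhomotopic_of_nullhomotopic_suIncl K (h K)
  have h2 : Subsingleton (π_ m (Matrix.specialUnitaryGroup (Fin 4) ℂ) 1) :=
    subsingleton_homotopyGroup_of_sphereMaps_nullhomotopic (N := m) h1 1
  exact subsingleton_homotopyGroup_specialOrthogonalGroup_six_of_specialUnitaryGroup hm h2

end Transfer

end SpinSix

/-! ### 4. The named fact from `π₆(SU(4)) = 0` -/

/-- **Bott's `π₆(SO(8)) = 0` (the named fact `Bott1959_sphereMapsToStableFramesExtend_six`) follows
from `π₆(SU(4), 1) = 0`**, the value delivered by complex Bott periodicity (`π₆(SU(4)) = π₆(U(4)) =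
π₆(U) = 0`; Bott 1959 §1: the `π_k(U)` are `0, ℤ` for `k` even, odd): `π₆(SU(4)) = 0 ⇒ π₆(SO(6)) = 0`
by the covering `SU(4) → SO(6)` (this file), `⇒ π₆(SO(7)) = 0` (`…Even.lean`, Steenrod §23.4),
`⇒ π₆(SO(8)) = 0 ⇔` the fact (`…Seven.lean`, `…Orthogonal.lean`). What remains unmechanised of the
fact is exactly `π₆(SU(4)) = 0`. [cite: Bott1959, §1, Corollary to Theorem II, (1.5), p. 315]
[cite: Porteous1995, Prop. 17.3] -/
theorem Bott1959_sphereMapsToStableFramesExtend_six_of_specialUnitaryGroup_four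
    (h : Subsingleton (π_ 6 (Matrix.specialUnitaryGroup (Fin 4) ℂ) 1)) :
    Bott1959_sphereMapsToStableFramesExtend_six :=
  Bott1959_sphereMapsToStableFramesExtend_six_of_specialOrthogonalGroup_six
    (SpinSix.subsingleton_homotopyGroup_specialOrthogonalGroup_six_of_specialUnitaryGroup (m := 6) (by norm_num) h)

/-- **The named fact from null-homotopy through `GL₄(ℂ)`**: if every continuous `𝕊⁶ → SU(4)` is
null-homotopic as a map into the invertible `4 × 4` complex matrices (e.g. because
`π₆(GL₄(ℂ)) = 0`, complex Bott periodicity in the stable range), then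
`Bott1959_sphereMapsToStableFramesExtend_six` holds. [cite: Bott1959, §1, (1.5), p. 315] -/
theorem Bott1959_sphereMapsToStableFramesExtend_six_of_nullhomotopic_suIncl
    (h : ∀ K : C(sphere (0 : EuclideanSpace ℝ (Fin 7)) 1, Matrix.specialUnitaryGroup (Fin 4) ℂ),
      (Literature.LinearAlgebra.Matrix.suIncl.comp K).Nullhomotopic) :
    Bott1959_sphereMapsToStableFramesExtend_six :=
  Bott1959_sphereMapsToStableFramesExtend_six_of_specialOrthogonalGroup_six
    (SpinSix.subsingleton_homotopyGroup_specialOrthogonalGroup_six_of_nullhomotopic_suIncl (m := 6) (by norm_num) h)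

end Literature.Topology.FourManifolds
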